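/-
Origin: written from primary sources — C. P. Mok, Mem. AMS 235 (2015) §1 Notation p. 5 (`U_{E/F}(1)` as the norm-one torus and the
centre of every `U_{E/F}(N)`); S. Kudla, *Seesaw dual reductive pairs* (1984) §1 (the torus `U(W₁) × U(W₂) ⊂ U(W₁ ⊕ W₂)` of a split
hermitian plane). Adapted: no. Elementary matrix algebra over the tree's `UnitaryGroupAdelicCenter`, `UnitaryGroupAdelicDet`,
`UnitaryGroupDirectSumCarriers`; kernel only, no records.
-/
import Literature.NumberTheory.Automorphic.UnitaryGroupAdelicDet
import Literature.NumberTheory.Automorphic.UnitaryGroupDirectSumCarriers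
import HarnessLib

/-!
# The unitary group of a hermitian LINE is `U(1)(𝔸_F)`, and the torus of two lines is diagonal

Two currency junctions for the see-saw torus `U(W₁) × U(W₂) ⊂ U(W₁ ⊕ W₂)` of a split hermitian plane:

* §1 for a `1 × 1` form `J = (j)`, `j ≠ 0`, the centre `u ↦ u · 1₁ : U(1)(𝔸_F) →* U(J)(𝔸_F)` (`UnitaryGroup.adelicCenter`, N = 1) is
  an ISOMORPHISM with inverse the determinant (`adelicDet`): **`adelicLineEquiv F E c j hj : adelicOne F E c ≃* adelic F E c 1 !![j]`**
  (`coe_adelicLineEquiv`: the matrix is `u · 1`; `adelicDet_adelicLineEquiv`, `adelicLineEquiv_adelicDet`) — so the norm-one idèles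
  (`UnitaryGroupAdelicOneTorus`: `adelicOne = relNormOneIdeles` for `[E:F] = 2`) ARE the adelic points of the unitary group of any
  hermitian line;
* §2 **`coe_adelicBlockDiag_adelicCenter`**: the block-diagonal element `u₁ · 1₁ ⊕ᶠ u₂ · 1₁ ∈ U(J₁ ⊕ᶠ J₂)(𝔸_F)` of two central line
  elements has matrix `diagonal ![u₁, u₂]` — the torus of the plane `W₁ ⊕ W₂` in the adapted basis is the DIAGONAL torus
  (`coe_adelicBlockDiag_adelicLineEquiv` the same through §1).

Provenance / use (Hodge-CM model-construction cell, rows `gen12`/`real34`): the PKG's see-saw torus `jT₁₂ : SeesawTorus L⁺ L →ₜ*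
U(diag(a₀,a₁))(𝔸)` (diagonal embedding of a pair of norm-one idèles) is, entry by entry, `adelicBlockDiag ∘ (adelicLineEquiv × adelicLineEquiv)`
read through `cmAdelicEquiv`; this file is the tree half of that identification (the PKG half is an `ext; fin_cases`).  Nothing here is a
claim of the manuscripts under adjudication.
-/

set_option autoImplicit false

noncomputable section

open scoped Matrix
open NumberField

namespace Literature.NumberTheory.Automorphic

namespace UnitaryGroup

/-! ## §1 `U(J)(𝔸_F) = U(1)(𝔸_F)` for a hermitian line -/

section Line

variable (F E : Type) [Field F] [Field E] [NumberField E] [Algebra F E] (c : E ≃ₐ[F] E) (j : E) (hj : j ≠ 0)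

omit [NumberField E] in
include hj in
/-- the `1 × 1` form `(j)` has nonzero determinant. [folklore] -/
theorem det_line_ne_zero : (!![j] : Matrix (Fin 1) (Fin 1) E).det ≠ 0 := by
  rwa [Matrix.det_fin_one_of]

/-- a `1 × 1` invertible matrix is its determinant times the identity. [folklore] -/
theorem coe_eq_det_smul_one (g : GL (Fin 1) (AdeleRing (𝓞 E) E)) :
    ((g : GL (Fin 1) (AdeleRing (𝓞 E) E)) : Matrix (Fin 1) (Fin 1) (AdeleRing (𝓞 E) E)) =
      ((g : Matrix (Fin 1) (Fin 1) (AdeleRing (𝓞 E) E))).det • (1 : Matrix (Fin 1) (Fin 1) (AdeleRing (𝓞 E) E)) := by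
  ext i k
  fin_cases i; fin_cases k
  simp

include hj in
/-- for a hermitian LINE every element of `U(J)(𝔸_F)` is central: `g = (det g) · 1₁` with `det g ∈ U(1)(𝔸_F)`. [folklore] -/
theorem adelicCenter_adelicDet_line (g : adelic F E c 1 !![j]) :
    adelicCenter F E c 1 !![j] (adelicDet F E c 1 !![j] (det_line_ne_zero E j hj) g) = g :=
  Subtype.ext (Units.ext ((coe_adelicCenter F E c 1 !![j] _).trans (coe_eq_det_smul_one E _).symm))

/-- **`U(1)(𝔸_F) ≃* U((j))(𝔸_F)`**: `u ↦ u · 1₁`, inverse `g ↦ det g`. [cite: Mok2014, §1 Notation p. 5] -/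
def adelicLineEquiv : adelicOne F E c ≃* adelic F E c 1 !![j] :=
  { adelicCenter F E c 1 !![j] with
    invFun := adelicDet F E c 1 !![j] (det_line_ne_zero E j hj)
    left_inv := fun u => (adelicDet_adelicCenter F E c 1 !![j] (det_line_ne_zero E j hj) u).trans (pow_one u)
    right_inv := fun g => adelicCenter_adelicDet_line F E c j hj g }

/-- `adelicLineEquiv` IS `adelicCenter` at `N = 1`. [folklore] -/
theorem adelicLineEquiv_apply (u : adelicOne F E c) : adelicLineEquiv F E c j hj u = adelicCenter F E c 1 !![j] u := rfl

/-- its inverse IS `adelicDet`. [folklore] -/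
theorem adelicLineEquiv_symm_apply (g : adelic F E c 1 !![j]) :
    (adelicLineEquiv F E c j hj).symm g = adelicDet F E c 1 !![j] (det_line_ne_zero E j hj) g := rfl

/-- matrix of `adelicLineEquiv u`: the scalar `u · 1₁`. [folklore] -/
theorem coe_adelicLineEquiv (u : adelicOne F E c) :
    (((adelicLineEquiv F E c j hj u : adelic F E c 1 !![j]) : GL (Fin 1) (AdeleRing (𝓞 E) E)) :
        Matrix (Fin 1) (Fin 1) (AdeleRing (𝓞 E) E)) =
      ((u : (AdeleRing (𝓞 E) E)ˣ) : AdeleRing (𝓞 E) E) • (1 : Matrix (Fin 1) (Fin 1) (AdeleRing (𝓞 E) E)) :=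
  coe_adelicCenter F E c 1 !![j] u

/-- `det (adelicLineEquiv u) = u`. [folklore] -/
theorem adelicDet_adelicLineEquiv (u : adelicOne F E c) :
    adelicDet F E c 1 !![j] (det_line_ne_zero E j hj) (adelicLineEquiv F E c j hj u) = u :=
  (adelicLineEquiv F E c j hj).symm_apply_apply u

/-- `adelicLineEquiv (det g) = g`. [folklore] -/
theorem adelicLineEquiv_adelicDet (g : adelic F E c 1 !![j]) :
    adelicLineEquiv F E c j hj (adelicDet F E c 1 !![j] (det_line_ne_zero E j hj) g) = g :=
  (adelicLineEquiv F E c j hj).apply_symm_apply g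

/-- `adelicLineEquiv` is continuous (subspace topologies on both sides; the scalar map `𝔸_Eˣ → GL₁(𝔸_E)` is continuous).
[folklore] -/
theorem continuous_adelicLineEquiv_symm : Continuous (adelicLineEquiv F E c j hj).symm :=
  continuous_adelicDet F E c 1 !![j] (det_line_ne_zero E j hj)

end Line

/-! ## §2 The torus of two lines in `U(J₁ ⊕ᶠ J₂)(𝔸_F)` is diagonal -/

section Torus

variable (F E : Type) [Field F] [Field E] [NumberField E] [Algebra F E] (c : E ≃ₐ[F] E)
  (J₁ J₂ : Matrix (Fin 1) (Fin 1) E)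

/-- **the block-diagonal of two central line elements is the diagonal matrix**:
`(u₁ · 1₁) ⊕ᶠ (u₂ · 1₁) = diagonal ![u₁, u₂]` in `GL₂(𝔸_E)`. [cite: Kudla1984, §1] -/
theorem coe_adelicBlockDiag_adelicCenter (u₁ u₂ : adelicOne F E c) :
    (((adelicBlockDiag F E c 1 1 J₁ J₂ (adelicCenter F E c 1 J₁ u₁, adelicCenter F E c 1 J₂ u₂) :
          adelic F E c (1 + 1) (finSum 1 1 J₁ J₂)) : GL (Fin (1 + 1)) (AdeleRing (𝓞 E) E)) :
        Matrix (Fin (1 + 1)) (Fin (1 + 1)) (AdeleRing (𝓞 E) E)) =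
      Matrix.diagonal ![((u₁ : (AdeleRing (𝓞 E) E)ˣ) : AdeleRing (𝓞 E) E), ((u₂ : (AdeleRing (𝓞 E) E)ˣ) : AdeleRing (𝓞 E) E)] := by
  rw [coe_adelicBlockDiag, coe_reindexGL, coe_blockDiagGL]
  ext i k
  fin_cases i <;> fin_cases k <;> rfl

variable (j₁ j₂ : E) (hj₁ : j₁ ≠ 0) (hj₂ : j₂ ≠ 0)

/-- the same through `adelicLineEquiv`: the torus `U(W₁) × U(W₂)` of the plane `W₁ ⊕ W₂` in the adapted basis is the diagonal
torus `(u₁, u₂) ↦ diagonal ![u₁, u₂]`. [cite: Kudla1984, §1] -/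
theorem coe_adelicBlockDiag_adelicLineEquiv (u₁ u₂ : adelicOne F E c) :
    (((adelicBlockDiag F E c 1 1 !![j₁] !![j₂] (adelicLineEquiv F E c j₁ hj₁ u₁, adelicLineEquiv F E c j₂ hj₂ u₂) :
          adelic F E c (1 + 1) (finSum 1 1 !![j₁] !![j₂])) : GL (Fin (1 + 1)) (AdeleRing (𝓞 E) E)) :
        Matrix (Fin (1 + 1)) (Fin (1 + 1)) (AdeleRing (𝓞 E) E)) =
      Matrix.diagonal ![((u₁ : (AdeleRing (𝓞 E) E)ˣ) : AdeleRing (𝓞 E) E), ((u₂ : (AdeleRing (𝓞 E) E)ˣ) : AdeleRing (𝓞 E) E)] :=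
  coe_adelicBlockDiag_adelicCenter F E c !![j₁] !![j₂] u₁ u₂

omit [NumberField E] in
/-- the split plane's form: `(j₁) ⊕ᶠ (j₂) = diagonal ![j₁, j₂]`. [folklore] -/
theorem finSum_line_line : (finSum 1 1 !![j₁] !![j₂] : Matrix (Fin (1 + 1)) (Fin (1 + 1)) E) = Matrix.diagonal ![j₁, j₂] := by
  ext i k
  fin_cases i <;> fin_cases k <;> rfl

end Torus

/-! ## §3 Determinants along the torus: `det (u₁ ⊕ᶠ u₂) = det u₁ · det u₂` -/

section Det

variable {S : Type*} [CommRing S] {N₁ N₂ : ℕ}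

/-- `det (J₁ ⊕ᶠ J₂) = det J₁ · det J₂`. [folklore] -/
theorem det_finSum (J₁ : Matrix (Fin N₁) (Fin N₁) S) (J₂ : Matrix (Fin N₂) (Fin N₂) S) :
    (finSum N₁ N₂ J₁ J₂).det = J₁.det * J₂.det := by
  rw [finSum, Matrix.det_reindex_self, Matrix.det_fromBlocks_zero₂₁]

/-- `det (J₁ ⊕ᶠ J₂) ≠ 0` when `det J₁ ≠ 0`, `det J₂ ≠ 0` (over a domain). [folklore] -/
theorem det_finSum_ne_zero [IsDomain S] {J₁ : Matrix (Fin N₁) (Fin N₁) S} {J₂ : Matrix (Fin N₂) (Fin N₂) S}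
    (h₁ : J₁.det ≠ 0) (h₂ : J₂.det ≠ 0) : (finSum N₁ N₂ J₁ J₂).det ≠ 0 := by
  rw [det_finSum]; exact mul_ne_zero h₁ h₂

end Det

section TorusDet

variable (F E : Type) [Field F] [Field E] [NumberField E] [Algebra F E] (c : E ≃ₐ[F] E) (M₁ M₂ : ℕ)
  (J₁ : Matrix (Fin M₁) (Fin M₁) E) (J₂ : Matrix (Fin M₂) (Fin M₂) E)

/-- the matrix determinant of `u₁ ⊕ᶠ u₂` is `det u₁ · det u₂`. [folklore] -/
theorem det_coe_adelicBlockDiag (u : adelic F E c M₁ J₁ × adelic F E c M₂ J₂) :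
    (((adelicBlockDiag F E c M₁ M₂ J₁ J₂ u : adelic F E c (M₁ + M₂) (finSum M₁ M₂ J₁ J₂)) :
          GL (Fin (M₁ + M₂)) (AdeleRing (𝓞 E) E)) : Matrix (Fin (M₁ + M₂)) (Fin (M₁ + M₂)) (AdeleRing (𝓞 E) E)).det =
      ((u.1 : GL (Fin M₁) (AdeleRing (𝓞 E) E)) : Matrix (Fin M₁) (Fin M₁) (AdeleRing (𝓞 E) E)).det *
        ((u.2 : GL (Fin M₂) (AdeleRing (𝓞 E) E)) : Matrix (Fin M₂) (Fin M₂) (AdeleRing (𝓞 E) E)).det := by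
  rw [coe_adelicBlockDiag, coe_reindexGL, coe_blockDiagGL, Matrix.det_reindex_self, Matrix.det_fromBlocks_zero₂₁]

/-- **`det (u₁ ⊕ᶠ u₂) = det u₁ · det u₂` in `U(1)(𝔸_F)`** — the determinant character of `U(J₁ ⊕ᶠ J₂)` restricted to the
see-saw torus `U(J₁) × U(J₂)` splits as the product of the two determinants (used to split a `χ ∘ det` normalisation of the
big pair's splitting along the torus). [cite: Kudla1984, §1] -/
theorem adelicDet_adelicBlockDiag (hJ₁ : J₁.det ≠ 0) (hJ₂ : J₂.det ≠ 0) (u : adelic F E c M₁ J₁ × adelic F E c M₂ J₂) :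
    adelicDet F E c (M₁ + M₂) (finSum M₁ M₂ J₁ J₂) (det_finSum_ne_zero hJ₁ hJ₂) (adelicBlockDiag F E c M₁ M₂ J₁ J₂ u) =
      adelicDet F E c M₁ J₁ hJ₁ u.1 * adelicDet F E c M₂ J₂ hJ₂ u.2 :=
  Subtype.ext (Units.ext (det_coe_adelicBlockDiag F E c M₁ M₂ J₁ J₂ u))

/-- the same for any proof of `det (J₁ ⊕ᶠ J₂) ≠ 0` (the value of `adelicDet` does not depend on it). [folklore] -/
theorem adelicDet_adelicBlockDiag' (hJ : (finSum M₁ M₂ J₁ J₂).det ≠ 0) (hJ₁ : J₁.det ≠ 0) (hJ₂ : J₂.det ≠ 0)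
    (u : adelic F E c M₁ J₁ × adelic F E c M₂ J₂) :
    adelicDet F E c (M₁ + M₂) (finSum M₁ M₂ J₁ J₂) hJ (adelicBlockDiag F E c M₁ M₂ J₁ J₂ u) =
      adelicDet F E c M₁ J₁ hJ₁ u.1 * adelicDet F E c M₂ J₂ hJ₂ u.2 :=
  Subtype.ext (Units.ext (det_coe_adelicBlockDiag F E c M₁ M₂ J₁ J₂ u))

/-- lines: `det (u₁ · 1₁ ⊕ᶠ u₂ · 1₁) = u₁ · u₂`. [folklore] -/
theorem adelicDet_adelicBlockDiag_adelicCenter (J₁' J₂' : Matrix (Fin 1) (Fin 1) E) (hJ₁ : J₁'.det ≠ 0) (hJ₂ : J₂'.det ≠ 0)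
    (u₁ u₂ : adelicOne F E c) :
    adelicDet F E c (1 + 1) (finSum 1 1 J₁' J₂') (det_finSum_ne_zero hJ₁ hJ₂)
        (adelicBlockDiag F E c 1 1 J₁' J₂' (adelicCenter F E c 1 J₁' u₁, adelicCenter F E c 1 J₂' u₂)) = u₁ * u₂ := by
  rw [adelicDet_adelicBlockDiag F E c 1 1 J₁' J₂' hJ₁ hJ₂, adelicDet_adelicCenter, adelicDet_adelicCenter, pow_one, pow_one]

end TorusDet

end UnitaryGroup

end Literature.NumberTheory.Automorphic

end
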